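import Summits.BirchSwinnertonDyer.BirchSwinnertonDyer.Theorems.RamifiedSevenEllipticUnitsLemmaXiFrame
import Summits.BirchSwinnertonDyer.Rank1Residual.X12.O11.RamifiedStrictDescent
import Summits.BirchSwinnertonDyer.Rank1Residual.X12.CMSevenAwayFromSeven
import HarnessLib

set_option linter.dupNamespace false
set_option autoImplicit false

/-!
# Lemma Ξ, kernel side (IX): clauses (P1) ∧ (P5) of `stub_rubinPackageSevenZp` on 𝒞₇, in the
# telescope's own currency — inputs: the O11 frame, `X12.ClassCSeven W`, and Deuring (ii)+(vi) for `φ`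

Helper file for the K7r Value crux `EllipticUnitValueSevenOfGZK` (stmt-BirchSwinnertonDyer-19945), line
`rubin-formula-zp` v4/v4.1, stub `stub_rubinPackageSevenZp` = `X12.O11.RamifiedCMRubinPackageAtZp W 7 (-11)`,
clauses (P1) `R.ξ = φ(φ∘cK)⁻¹` and (P5) `‖avatarValueAt R.r γ − 1‖² = 7⁻¹`. File (VIII)
(`…LemmaXiFrame`) proved both from Deuring's shape of `φ` given `IsImaginaryQuadratic K`,
`discr K = −p`, `5 ≤ p`, `𝔭 ∋ p`; the O11 frame `X12.O11.IsFrame W 7 K 𝔭 W' C` carries exactly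
`IsImaginaryQuadratic K`, `discr K = cmFieldDiscrOfJ W.j`, `5 ≤ 7`, `(7 : 𝓞 K) ∈ 𝔭`, and
`X12.ClassCSeven W` gives `cmFieldDiscrOfJ W.j = −7`. RESULT `RubinPadicLFunctionData.ξ_eq_φac_and_norm_sq_seven`:
inside the telescope of the package (frame, `κ`, `γ`, `ι`, `φ`, `D`, …), for the line owner's chosen
complex conjugation `cK ≠ 1` and every Rubin datum `R`, (P1) ∧ (P5) follow from Deuring (ii)
`IsHeckeConjEquivariant cK φ` and (vi) «off a finite set: `φ` unramified at `w`, `φ(ϖ_w) = σ'(α)`,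
`(α) = w`» — the two printed clauses of Silverman ATAEC II Thm. 9.2 / Cor. 10.4.1 (a) for the
Grössencharacter of `W` (cell typing ask W50 for (vi); (ii) is clause (ii) of the tree's
`Deuring_exists_heckeCharacter_of_maximalCM`).

References: Silverman, *Advanced Topics*, II Thm. 9.2, Cor. 10.4.1; [BKNO] arXiv:2608.06879 Def. 4.2, 4.7.
-/

noncomputable section

open scoped Classical NNReal Topology Pointwise ComplexConjugate
open NumberField IsDedekindDomain Field
  Literature.NumberTheory.EllipticCurves
  Literature.NumberTheory.EllipticCurves.BurungaleKobayashiNakamuraOta2026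
  Literature.NumberTheory.GaloisRepresentations
  Summit.BirchSwinnertonDyer.Rank1Residual

namespace Summit.BirchSwinnertonDyer.BirchSwinnertonDyer.Theorems.RamifiedSevenEllipticUnits

section Seven

open LemmaXi

variable {W : WeierstrassCurve ℚ} [W.IsElliptic] [W.IsGloballyMinimal] [hp : Fact (Nat.Prime 7)]
  {K : Type} [Field K] [NumberField K] {cK : K ≃ₐ[ℚ] K} {𝔭 : HeightOneSpectrum (𝓞 K)}
  {W' : WeierstrassCurve ℚ} {C : WeierstrassCurve.VariableChange ℚ}
  {κ : ZpExtension K 7} {γ : absoluteGaloisGroup K} {ι : PadicAlgCl 7 ≃+* ℂ} {φ : HeckeCharacter K}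
  {Ω : ℂ} {𝓔 : AcDualExpSystem W 7 K 𝔭 κ ι} {D : EllipticUnitClassData W 7 K 𝔭 κ γ ι φ Ω 𝓔}

/-- **(P1) ∧ (P5) on 𝒞₇ from Deuring's shape of `φ`.** In the telescope of `stub_rubinPackageSevenZp`
(`IsFrame W 7 K 𝔭 W' C`, `ClassCSeven W`, `κ`, topological generator `γ`, `ι`, `φ`, class datum `D`),
for a complex conjugation `cK ≠ 1` of `K` and ANY Rubin `7`-adic `L`-function datum `R` over `D`: if
`φ` is conjugation-equivariant (Deuring (ii)) and, off a finite set of places, unramified at `w` with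
`φ(ϖ_w) = σ'(α_w)`, `(α_w) = w`, for a fixed embedding `σ' : K →+* ℂ` (Deuring (vi)), then
`R.ξ = φ(φ∘cK)⁻¹` (P1) and `‖avatarValueAt R.r γ − 1‖² = 7⁻¹` (P5).
[cite: BurungaleKobayashiNakamuraOta2026, Def. 4.2 and Def. 4.7 (arXiv:2608.06879 pp. 24, 27) (claim; preprint; fields of the datum)]
[cite: SilvermanATAEC1994, Ch. II Thm. 9.2 and Cor. 10.4.1 (a)] -/
theorem RubinPadicLFunctionData.ξ_eq_φac_and_norm_sq_seven [Fact (κ.IsTopGenerator γ)]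
    (R : RubinPadicLFunctionData W 7 K cK 𝔭 κ γ ι φ Ω 𝓔 D)
    (hF : X12.O11.IsFrame W 7 K 𝔭 W' C) (hC : X12.ClassCSeven W) (hc : cK ≠ 1) (σ' : K →+* ℂ)
    (heq : IsHeckeConjEquivariant cK φ)
    (hvals : ∃ S : Set (HeightOneSpectrum (𝓞 K)), S.Finite ∧ ∀ w ∉ S,
      φ.IsUnramifiedAt w ∧ ∃ α : 𝓞 K, Ideal.span {α} = w.asIdeal ∧ φ.valueAtUniformizer w = σ' (α : K)) :
    R.ξ = φ * (HeckeCharacter.galConj cK φ)⁻¹ ∧ ‖avatarValueAt R.r γ - 1‖ ^ 2 = ((7 : ℝ))⁻¹ := by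
  obtain ⟨-, -, h5, hK, hd, hp𝔭, -⟩ := hF
  have hd' : NumberField.discr K = -((7 : ℕ) : ℤ) := by rw [hd, hC.2.1]; norm_num
  have h := RubinPadicLFunctionData.ξ_eq_φac_and_norm_sq_of_frame R hK hd' h5 hp𝔭 hc σ' heq hvals
  simpa using h

/-- **Same, with Deuring (vi) in its printed «at every unramified place» shape** (the form of the
cell's typing ask W50: `∀ w, φ.IsUnramifiedAt w → ∃ α, Ideal.span {α} = w.asIdeal ∧ φ(ϖ_w) = σ'(α)`):
the exceptional set is the (finite) set of ramified places of `φ` (`finite_ramifiedPlaces_holds`).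
[cite: SilvermanATAEC1994, Ch. II Thm. 9.2 and Cor. 10.4.1 (a)]
[cite: BurungaleKobayashiNakamuraOta2026, Def. 4.2 and Def. 4.7 (arXiv:2608.06879 pp. 24, 27) (claim; preprint; fields of the datum)] -/
theorem RubinPadicLFunctionData.ξ_eq_φac_and_norm_sq_seven_of_deuring [Fact (κ.IsTopGenerator γ)]
    (R : RubinPadicLFunctionData W 7 K cK 𝔭 κ γ ι φ Ω 𝓔 D)
    (hF : X12.O11.IsFrame W 7 K 𝔭 W' C) (hC : X12.ClassCSeven W) (hc : cK ≠ 1) (σ' : K →+* ℂ)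
    (heq : IsHeckeConjEquivariant cK φ)
    (hvi : ∀ w : HeightOneSpectrum (𝓞 K), φ.IsUnramifiedAt w →
      ∃ α : 𝓞 K, Ideal.span {α} = w.asIdeal ∧ φ.valueAtUniformizer w = σ' (α : K)) :
    R.ξ = φ * (HeckeCharacter.galConj cK φ)⁻¹ ∧ ‖avatarValueAt R.r γ - 1‖ ^ 2 = ((7 : ℝ))⁻¹ := by
  have hfin : ∀ᶠ w : HeightOneSpectrum (𝓞 K) in Filter.cofinite, φ.IsUnramifiedAt w :=
    φ.finite_ramifiedPlaces_iff.1 (HeckeCharacter.finite_ramifiedPlaces_holds φ)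
  rw [Filter.eventually_cofinite] at hfin
  refine RubinPadicLFunctionData.ξ_eq_φac_and_norm_sq_seven R hF hC hc σ' heq ⟨_, hfin, fun w hw ↦ ?_⟩
  have hunr : φ.IsUnramifiedAt w := by
    by_contra h
    exact hw h
  exact ⟨hunr, hvi w hunr⟩

end Seven

end Summit.BirchSwinnertonDyer.BirchSwinnertonDyer.Theorems.RamifiedSevenEllipticUnits

end
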